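import Summits.ResolutionOfSingularities.ResolutionOfSingularities.Theorems.PurelyInseparableDim4EquimultipleScope
import Summits.ResolutionOfSingularities.ResolutionOfSingularities.Theorems.PurelyInseparableDim4IsolationCert
import Literature.AlgebraicGeometry.Resolution.HironakaGroupSchemeAdditiveGenerators
import Literature.AlgebraicGeometry.Resolution.HasseSchmidtCoefficients
import Literature.AlgebraicGeometry.Resolution.HasseSchmidtDiffEqDiffOp
import Literature.AlgebraicGeometry.Resolution.OrdZeroBasics
import Literature.RingTheory.MvPolynomial.IdealOfVarsBasics
import Mathlib.RingTheory.Ideal.MinimalPrime.Basic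
import HarnessLib

/-!
# The `p`-fold locus of `z^p + F` at the level of PRIME IDEALS: an isolated `p`-fold point is the only
# prime under the origin at which `z^p + F` is symbolically `p`-fold (cell `res-dim4-pi`, row (I) algebra atom)

[OURS · counted 0 · AI work weaker than expert review.]  Cell `res-dim4-pi` (D-0157 DOOR 2), seat
`res-dim4-p-11` g2 (width copy of res-dim4-p-1).  NOTHING here proves row (I) `E2OfCJS.IsolationRow`,
`NoIsolatedTrap 3 3`, or resolution of singularities in dimension ≥ 4 / characteristic `p`.

Row (I) `E2OfCJS.IsolationRow` (p663940, res-dim4-p-2 g2) asks: a LOCAL scheme presented by `F` with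
`IsIsolated 3 F` has its closed point isolated in its Hilbert–Samuel locus.  Through the tree's Bennett
dictionary (`Helpers.hsFun_eq_hypersurfaceHFe_of_stalk_ringEquiv`, `hypersurfaceHFe_injective`) the
Hilbert–Samuel function of the hypersurface `z^p + F` at the point of `𝔸⁵` given by a prime `Q ∋ z^p + F` is
the hypersurface function of the ORDER of `z^p + F` in the regular local ring `L[z,x]_Q`, and that order is
`≥ m` iff `z^p + F` lies in the SYMBOLIC power `Q^{(m)} = {g | ∃ s ∉ Q, s·g ∈ Q^m}` (tree
`HironakaScheme.symbPow`; bridges to `𝔪_Q^m ⊆ L[z,x]_Q` in `CoeffDerivation`).  This file settles the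
resulting statement of pure polynomial algebra — res-dim4-p-9 g2's cut (I1) «Zariski–Nagata atom» + the
`IsIsolated` glue (K-SPLIT 2026-08-28T20:04:53Z) — in every characteristic and for every exponent `p ≥ 1`:

* §1 `hasseDeriv_mapDomain_rename` — the tree's Hasse–Schmidt derivatives `D^{(α)}`
  (`Literature.AlgebraicGeometry.Resolution.hasseDeriv`) commute with an injective renaming of the
  variables; hence (§2) for `g = hyp p F = z^p + F(x)`:  `D^{(α)} g = D^{(α)} F` for `α ≠ 0` supported in the
  `x`-variables (`hasseDeriv_mapDomain_hyp`) and `D^{(p·e_z)} g = 1` (`hasseDeriv_single_zero_hyp`).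
* §3 THE EASY HALF OF ZARISKI–NAGATA, READ FOR `z^p + F` (the tree's `HironakaScheme.hasseDeriv_mem_symbPow`:
  `D^{(β)}(Q^{(m)}) ⊆ Q^{(m − |β|)}` for every prime `Q` of a polynomial ring over a field):
  **`rename_hasseDeriv_mem_of_hyp_mem_symbPow`** — if `z^p + F ∈ Q^{(p)}` then `D^{(α)} F ∈ Q` for all
  `0 < |α| < p`, i.e. **`singLocusIdeal_le_comap_of_hyp_mem_symbPow`**: the frame's `p`-fold-locus ideal
  `J_p⁺(F)` lies in `Q ∩ L[x]`; and the ORDER CAP **`hyp_not_mem_symbPow_succ`** — `z^p + F ∉ Q^{(p+1)}` for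
  every prime `Q` (the `z`-derivative of order `p` of `z^p + F` is `1`), so `z^p + F` has order `≤ p` at every
  point of `𝔸⁵`, closed or not.
* §4 **`eq_idealOfVars_of_hyp_mem_symbPow`** — if `F(0) = 0`, `IsIsolated p F`, `Q ⊆ (z, x₁, …, x₄)` is prime
  and `z^p + F ∈ Q^{(p)}`, then `Q = (z, x₁, …, x₄)`: the prime `Q ∩ L[x] ⊇ J_p⁺(F)` under `𝔪₀` is `𝔪₀` by
  isolation, so `x ⊆ Q`, `F ∈ Q`, `z^p = g − F ∈ Q`, `z ∈ Q`.  Contrapositive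
  **`hyp_not_mem_symbPow_of_ne`**: at every prime STRICTLY under the origin the symbolic order of `z^p + F` is
  `< p`.  With §3 and the origin itself (`hyp_mem_idealOfVars_pow`: `z^p + F ∈ 𝔪^p` when `ord₀ F ≥ p`) this is
  the complete order profile of `z^p + F` over the local scheme at an isolated `p`-fold point: order EXACTLY
  `p` at the closed point, `< p` (and `≥ 1` on `V(z^p + F)`) everywhere else — what row (I) consumes once
  res-dim4-p-2's points-of-a-local-scheme ↔ primes dictionary is in place.

Def-free over the tree's `PIDim4.hyp`, `PIDim4.singLocusIdeal`, `PIDim4.IsIsolated`, `PIDim4.originIdeal`,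
`Resolution.hasseDeriv`, `HironakaScheme.symbPow`, `MvPolynomial.idealOfVars`.  No characteristic and no
perfectness hypothesis is needed at this level (perfectness enters row (I) only through the presentation /
the identification of closed points).  bears_on: LADDER-RESOLUTION:D157-DOOR2 (res-dim4-pi · F4-I(3,3) ·
row (I) algebra atom).  Supports stmt-ResolutionOfSingularities-16155 (helper).

## Sources

* B. Dietel, Dissertation Regensburg (2015), Lemma (9.1.4) p. 108 (`D_M(𝔭^{(d)}) ⊆ 𝔭^{(d−|M|)}`) — via the
  tree's `HironakaScheme.hasseDeriv_mem_symbPow`. [Dietel2015]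
* A. Grothendieck, ÉGA IV₄ Thm. 16.11.2 ((16.11.2.1): `D_p(z^q) = (q choose p) z^{q−p}`). [EGAIV4]
* H. Matsumura, Commutative Ring Theory (1986), §6 / Thm. 4.1 (symbolic powers `P^{(n)} = P^n A_P ∩ A`).
  [Matsumura1987]
-/

set_option linter.dupNamespace false -- mandated namespace of this single-conjunct summit

noncomputable section

open MvPolynomial Finset
open Literature.AlgebraicGeometry
open Literature.AlgebraicGeometry.Resolution.Hauser2010 (ordZero natCast_le_ordZero_iff_forall_coeff)

namespace Summit.ResolutionOfSingularities.ResolutionOfSingularities.Theorems.PIDim4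

namespace SymbolicPower

/-! ## §1 Hasse–Schmidt derivatives across an injective renaming of the variables -/

section Rename

variable {R : Type*} [CommRing R] {σ τ : Type*} {f : σ → τ}

/-- Truncated subtraction of exponents commutes with an injective re-indexing:
`(β − α) ∘ f⁻¹ = β ∘ f⁻¹ − α ∘ f⁻¹`. OURS (bookkeeping). [folklore] -/
theorem mapDomain_tsub (hf : Function.Injective f) (α β : σ →₀ ℕ) :
    (β - α).mapDomain f = β.mapDomain f - α.mapDomain f := by
  ext t
  rw [Finsupp.tsub_apply]
  by_cases ht : t ∈ Set.range f
  · obtain ⟨i, rfl⟩ := ht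
    rw [Finsupp.mapDomain_apply hf, Finsupp.mapDomain_apply hf, Finsupp.mapDomain_apply hf,
      Finsupp.tsub_apply]
  · rw [Finsupp.mapDomain_notin_range _ _ ht, Finsupp.mapDomain_notin_range _ _ ht,
      Finsupp.mapDomain_notin_range _ _ ht, tsub_zero]

/-- **The Hasse–Schmidt derivatives commute with an injective renaming of the variables**:
`D^{(α ∘ f⁻¹)}(rename f G) = rename f (D^{(α)} G)` (on monomials both sides are
`(∏ᵢ C(βᵢ, αᵢ)) · x^{(β − α) ∘ f⁻¹}`). [cite: EGAIV4, Thm. 16.11.2 ((16.11.2.1))] -/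
theorem hasseDeriv_mapDomain_rename [DecidableEq σ] [DecidableEq τ] (hf : Function.Injective f)
    (α : σ →₀ ℕ) (G : MvPolynomial σ R) :
    Resolution.hasseDeriv R (α.mapDomain f) (rename f G) = rename f (Resolution.hasseDeriv R α G) := by
  induction G using MvPolynomial.induction_on' with
  | monomial β c =>
    rw [rename_monomial, Resolution.hasseDeriv_monomial, Resolution.hasseDeriv_monomial, map_mul,
      map_natCast, rename_monomial, mapDomain_tsub hf]
    congr 2
    rw [Finsupp.mapDomain_support_of_injective hf, Finset.prod_image fun x _ y _ h => hf h]
    refine Finset.prod_congr rfl fun i _ => ?_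
    rw [Finsupp.mapDomain_apply hf, Finsupp.mapDomain_apply hf]
  | add p q hp hq => rw [map_add, map_add, hp, hq, ← map_add, ← map_add]

end Rename

/-! ## §2 The derivatives of `z^p + F` -/

variable {L : Type} [Field L]

/-- `F(x₁, …, x₄)`, read in `L[z, x₁, …, x₄]`, does not involve `z = X 0`. OURS (bookkeeping). [folklore] -/
theorem rename_succ_mem_supported (F : MvPolynomial (Fin 4) L) :
    rename Fin.succ F ∈ supported L (({0} : Set (Fin (4 + 1)))ᶜ) := by
  classical
  rw [mem_supported]
  intro i hi
  obtain ⟨j, -, rfl⟩ := Finset.mem_image.mp (vars_rename Fin.succ F hi)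
  simp [Fin.succ_ne_zero]

/-- `z^p` involves only `z = X 0`. OURS (bookkeeping). [folklore] -/
theorem X_zero_pow_mem_supported (p : ℕ) :
    (X 0 ^ p : MvPolynomial (Fin (4 + 1)) L) ∈ supported L ({0} : Set (Fin (4 + 1))) :=
  pow_mem (X_mem_supported.mpr (Set.mem_singleton (0 : Fin (4 + 1)))) p

/-- **`D^{(α)}(z^p + F) = D^{(α)} F` for `α ≠ 0` supported in the `x`-variables** (a derivative in an
`x`-direction kills `z^p`; the derivatives of `F` are those of `F` read in `L[z, x]`).
[cite: EGAIV4, Thm. 16.11.2 ((16.11.2.1))] -/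
theorem hasseDeriv_mapDomain_hyp (p : ℕ) (F : MvPolynomial (Fin 4) L) {α : Fin 4 →₀ ℕ} (hα : α ≠ 0) :
    Resolution.hasseDeriv L (α.mapDomain Fin.succ) (hyp p F) =
      rename Fin.succ (Resolution.hasseDeriv L α F) := by
  classical
  obtain ⟨i, hi⟩ : ∃ i, α i ≠ 0 := by
    by_contra h
    push Not at h
    exact hα (Finsupp.ext h)
  rw [hyp, map_add, hasseDeriv_mapDomain_rename (Fin.succ_injective 4),
    Resolution.hasseDeriv_eq_zero_of_mem_supported L (X_zero_pow_mem_supported p) (i := i.succ)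
      (by simp [Fin.succ_ne_zero]) (by rwa [Finsupp.mapDomain_apply (Fin.succ_injective 4)]), zero_add]

/-- **`D^{(p·e_z)}(z^p + F) = 1`** (`p ≠ 0`): the binomial value `D^{(p e_z)} z^p = 1` in every
characteristic, and the `z`-derivative kills `F`. [cite: EGAIV4, Thm. 16.11.2 ((16.11.2.1))] -/
theorem hasseDeriv_single_zero_hyp {p : ℕ} (hp : p ≠ 0) (F : MvPolynomial (Fin 4) L) :
    Resolution.hasseDeriv L (Finsupp.single 0 p) (hyp p F) = 1 := by
  classical
  rw [hyp, map_add, Resolution.hasseDeriv_X_pow, Nat.choose_self, Nat.cast_one, Nat.sub_self, pow_zero,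
    mul_one, Resolution.hasseDeriv_eq_zero_of_mem_supported L (rename_succ_mem_supported F) (i := 0)
      (by simp) (by simp [hp]), add_zero]

/-! ## §3 Symbolic powers at a prime: the easy half of Zariski–Nagata read for `z^p + F`, and the order cap -/

/-- A positive symbolic power of a prime lies in the prime: `Q^{(m)} ⊆ Q` for `m ≠ 0` (`s·g ∈ Q^m ⊆ Q`,
`s ∉ Q`). [cite: Matsumura1987, §6 / Thm. 4.1 (symbolic powers)] -/
theorem mem_of_mem_symbPow {σ : Type*} {Q : Ideal (MvPolynomial σ L)} [hQ : Q.IsPrime] {m : ℕ}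
    (hm : m ≠ 0) {g : MvPolynomial σ L} (hg : g ∈ Resolution.HironakaScheme.symbPow L Q m) : g ∈ Q := by
  obtain ⟨s, hs, hsg⟩ := hg
  exact (hQ.mem_or_mem (Ideal.pow_le_self hm hsg)).resolve_left hs

/-- **ORDER CAP: `z^p + F` is nowhere `(p+1)`-fold.**  For every prime `Q` of `L[z, x]`,
`z^p + F ∉ Q^{(p+1)}`: otherwise `1 = D^{(p e_z)}(z^p + F) ∈ Q^{(1)} ⊆ Q`
(`HironakaScheme.hasseDeriv_mem_symbPow`). [cite: Dietel2015, Lemma (9.1.4) p. 108] -/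
theorem hyp_not_mem_symbPow_succ {p : ℕ} (hp : p ≠ 0) (F : MvPolynomial (Fin 4) L)
    {Q : Ideal (MvPolynomial (Fin (4 + 1)) L)} [hQ : Q.IsPrime] :
    hyp p F ∉ Resolution.HironakaScheme.symbPow L Q (p + 1) := by
  intro h
  have h1 := Resolution.HironakaScheme.hasseDeriv_mem_symbPow h (Finsupp.single 0 p)
  rw [Finsupp.degree_single, Nat.add_sub_cancel_left, hasseDeriv_single_zero_hyp hp] at h1
  exact hQ.ne_top ((Ideal.eq_top_iff_one Q).mpr (mem_of_mem_symbPow one_ne_zero h1))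

/-- The order cap for every `m > p`: `z^p + F ∉ Q^{(m)}`. [cite: Dietel2015, Lemma (9.1.4) p. 108] -/
theorem hyp_not_mem_symbPow_of_lt {p m : ℕ} (hp : p ≠ 0) (hpm : p < m) (F : MvPolynomial (Fin 4) L)
    {Q : Ideal (MvPolynomial (Fin (4 + 1)) L)} [Q.IsPrime] :
    hyp p F ∉ Resolution.HironakaScheme.symbPow L Q m := fun h =>
  hyp_not_mem_symbPow_succ hp F (Resolution.HironakaScheme.symbPow_mono hpm h)

/-- **Zariski–Nagata, the easy half, for `z^p + F`**: if `z^p + F` lies in the symbolic power `Q^{(p)}`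
of a prime `Q` of `L[z, x]`, then every Hasse derivative `D^{(α)} F` with `0 < |α| < p`, read in `L[z, x]`,
lies in `Q` (`D^{(α)}(Q^{(p)}) ⊆ Q^{(p − |α|)} ⊆ Q` and `D^{(α)}(z^p + F) = D^{(α)} F`).
[cite: Dietel2015, Lemma (9.1.4) p. 108] -/
theorem rename_hasseDeriv_mem_of_hyp_mem_symbPow {p : ℕ} (F : MvPolynomial (Fin 4) L)
    {Q : Ideal (MvPolynomial (Fin (4 + 1)) L)} [Q.IsPrime]
    (h : hyp p F ∈ Resolution.HironakaScheme.symbPow L Q p) {α : Fin 4 →₀ ℕ} (h0 : 0 < α.degree)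
    (hαp : α.degree < p) : rename Fin.succ (Resolution.hasseDeriv L α F) ∈ Q := by
  classical
  have hα : α ≠ 0 := by
    rintro rfl
    rw [map_zero] at h0
    exact lt_irrefl 0 h0
  have h1 := Resolution.HironakaScheme.hasseDeriv_mem_symbPow h (α.mapDomain Fin.succ)
  rw [Finsupp.degree_mapDomain, hasseDeriv_mapDomain_hyp p F hα] at h1
  exact mem_of_mem_symbPow (by omega) h1

/-- **The frame's `p`-fold-locus ideal lies in `Q ∩ L[x]`**: `J_p⁺(F) ≤ (rename succ)⁻¹ Q` whenever
`z^p + F ∈ Q^{(p)}`. [cite: Dietel2015, Lemma (9.1.4) p. 108] -/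
theorem singLocusIdeal_le_comap_of_hyp_mem_symbPow {p : ℕ} (F : MvPolynomial (Fin 4) L)
    {Q : Ideal (MvPolynomial (Fin (4 + 1)) L)} [Q.IsPrime]
    (h : hyp p F ∈ Resolution.HironakaScheme.symbPow L Q p) :
    singLocusIdeal p F ≤ Q.comap (rename Fin.succ) := by
  rw [singLocusIdeal, Ideal.span_le]
  rintro _ ⟨α, h0, hq, rfl⟩
  rw [SetLike.mem_coe, Ideal.mem_comap, Equimultiple.hasseDeriv_eq]
  exact rename_hasseDeriv_mem_of_hyp_mem_symbPow F h h0 hq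

/-- The same in `map` form: `J_p⁺(F)·L[z, x] ≤ Q`. [cite: Dietel2015, Lemma (9.1.4) p. 108] -/
theorem singLocusIdeal_map_le_of_hyp_mem_symbPow {p : ℕ} (F : MvPolynomial (Fin 4) L)
    {Q : Ideal (MvPolynomial (Fin (4 + 1)) L)} [Q.IsPrime]
    (h : hyp p F ∈ Resolution.HironakaScheme.symbPow L Q p) :
    (singLocusIdeal p F).map (rename Fin.succ) ≤ Q :=
  Ideal.map_le_iff_le_comap.mpr (singLocusIdeal_le_comap_of_hyp_mem_symbPow F h)

/-! ## §4 Isolation at the level of primes -/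

/-- `(rename succ)⁻¹ (z, x₁, …, x₄) = (x₁, …, x₄)` (constant coefficients are unchanged by renaming).
OURS (bookkeeping). [folklore] -/
theorem comap_rename_succ_idealOfVars :
    (MvPolynomial.idealOfVars (Fin (4 + 1)) L).comap (rename Fin.succ) =
      MvPolynomial.idealOfVars (Fin 4) L := by
  ext G
  rw [Ideal.mem_comap, Literature.RingTheory.MvPolynomial.mem_idealOfVars_iff_constantCoeff_eq_zero,
    Literature.RingTheory.MvPolynomial.mem_idealOfVars_iff_constantCoeff_eq_zero, constantCoeff_rename]

/-- The frame's origin ideal of `L[x₁, …, x₄]` is the pull-back of the origin ideal of `L[z, x]`.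
OURS (bookkeeping). [folklore] -/
theorem comap_rename_succ_idealOfVars_eq_originIdeal :
    (MvPolynomial.idealOfVars (Fin (4 + 1)) L).comap (rename Fin.succ) = originIdeal L := by
  rw [comap_rename_succ_idealOfVars, IsolationCert.originIdeal_eq_idealOfVars]

/-- **ISOLATION AT THE LEVEL OF PRIMES.**  Let `F ∈ L[x₁, …, x₄]` with `F(0) = 0` be such that the origin
is an ISOLATED `p`-fold point of `z^p + F` (`IsIsolated p F`: every minimal prime of `J_p⁺(F)` under `𝔪₀` is
`𝔪₀`).  If `Q ⊆ 𝔪 = (z, x₁, …, x₄)` is a prime of `L[z, x]` at which `z^p + F` is symbolically `p`-fold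
(`z^p + F ∈ Q^{(p)}`), then `Q = 𝔪`.  Proof: `Q ∩ L[x]` is a prime containing `J_p⁺(F)` (§3) under `𝔪₀`,
hence contains a minimal prime of `J_p⁺(F)` under `𝔪₀`, which is `𝔪₀` — so `x₁, …, x₄ ∈ Q`, `F ∈ Q`,
`z^p = (z^p + F) − F ∈ Q`, `z ∈ Q`. [cite: Dietel2015, Lemma (9.1.4) p. 108]
[cite: Matsumura1987, §6 / Thm. 4.1 (symbolic powers)] -/
theorem eq_idealOfVars_of_hyp_mem_symbPow {p : ℕ} (hp : p ≠ 0) {F : MvPolynomial (Fin 4) L}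
    (hF : constantCoeff F = 0) (hiso : IsIsolated p F)
    {Q : Ideal (MvPolynomial (Fin (4 + 1)) L)} [hQ : Q.IsPrime]
    (hQle : Q ≤ MvPolynomial.idealOfVars (Fin (4 + 1)) L)
    (h : hyp p F ∈ Resolution.HironakaScheme.symbPow L Q p) :
    Q = MvPolynomial.idealOfVars (Fin (4 + 1)) L := by
  -- the contracted prime `Q₀ = Q ∩ L[x]` contains `J_p⁺(F)` and lies under `𝔪₀`, hence is `𝔪₀`
  have hJ : singLocusIdeal p F ≤ Q.comap (rename Fin.succ) :=
    singLocusIdeal_le_comap_of_hyp_mem_symbPow F h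
  have hQ₀le : Q.comap (rename Fin.succ) ≤ originIdeal L := by
    rw [← comap_rename_succ_idealOfVars_eq_originIdeal]
    exact Ideal.comap_mono hQle
  obtain ⟨P, hPmin, hPQ₀⟩ := Ideal.exists_minimalPrimes_le hJ
  have hP : P = originIdeal L := hiso.2 P hPmin (hPQ₀.trans hQ₀le)
  have hQ₀eq : Q.comap (rename Fin.succ) = originIdeal L := le_antisymm hQ₀le (hP ▸ hPQ₀)
  -- hence every variable lies in `Q`
  refine le_antisymm hQle ?_
  rw [MvPolynomial.idealOfVars, Ideal.span_le]
  rintro _ ⟨i, rfl⟩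
  rw [SetLike.mem_coe]
  refine Fin.cases ?_ (fun j => ?_) i
  · -- `z`: `z^p = (z^p + F) − F ∈ Q`
    have hg : hyp p F ∈ Q := mem_of_mem_symbPow hp h
    have hF' : rename Fin.succ F ∈ Q := by
      rw [← Ideal.mem_comap, hQ₀eq, IsolationCert.originIdeal_eq_idealOfVars,
        Literature.RingTheory.MvPolynomial.mem_idealOfVars_iff_constantCoeff_eq_zero]
      exact hF
    have hz : (X 0 : MvPolynomial (Fin (4 + 1)) L) ^ p ∈ Q := by
      have h' := sub_mem hg hF'
      rwa [hyp, add_sub_cancel_right] at h'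
    exact hQ.mem_of_pow_mem p hz
  · -- `xⱼ`: `xⱼ ∈ 𝔪₀ = Q ∩ L[x]`
    have hx : (X j : MvPolynomial (Fin 4) L) ∈ Q.comap (rename Fin.succ) := by
      rw [hQ₀eq, IsolationCert.originIdeal_eq_idealOfVars]
      exact Literature.RingTheory.MvPolynomial.X_mem_idealOfVars j
    rw [Ideal.mem_comap, rename_X] at hx
    exact hx

/-- **Contrapositive: strictly under the origin, `z^p + F` is NOT symbolically `p`-fold** — at every prime
`Q ⊊ (z, x₁, …, x₄)` of `L[z, x]` the order of `z^p + F` in `L[z, x]_Q` is `< p` (isolated `p`-fold point,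
`F(0) = 0`). [cite: Dietel2015, Lemma (9.1.4) p. 108] -/
theorem hyp_not_mem_symbPow_of_ne {p : ℕ} (hp : p ≠ 0) {F : MvPolynomial (Fin 4) L}
    (hF : constantCoeff F = 0) (hiso : IsIsolated p F)
    {Q : Ideal (MvPolynomial (Fin (4 + 1)) L)} [Q.IsPrime]
    (hQle : Q ≤ MvPolynomial.idealOfVars (Fin (4 + 1)) L) (hne : Q ≠ MvPolynomial.idealOfVars (Fin (4 + 1)) L) :
    hyp p F ∉ Resolution.HironakaScheme.symbPow L Q p := fun h =>
  hne (eq_idealOfVars_of_hyp_mem_symbPow hp hF hiso hQle h)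

/-! ## §5 At the origin itself: `z^p + F ∈ 𝔪^p` when `ord₀ F ≥ p` -/

/-- `z^p + F ∈ (z, x₁, …, x₄)^p` when every monomial of `F` has degree `≥ p` (`ord₀ F ≥ p`).
[cite: ZariskiSamuel1960, Vol. II Ch. VII §1 p.129 (order of a power series)] -/
theorem hyp_mem_idealOfVars_pow {p : ℕ} {F : MvPolynomial (Fin 4) L} (hF : (p : ℕ∞) ≤ ordZero F) :
    hyp p F ∈ MvPolynomial.idealOfVars (Fin (4 + 1)) L ^ p := by
  classical
  refine add_mem (Ideal.pow_mem_pow (Literature.RingTheory.MvPolynomial.X_mem_idealOfVars 0) p) ?_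
  rw [natCast_le_ordZero_iff_forall_coeff] at hF
  rw [MvPolynomial.mem_pow_idealOfVars_iff']
  intro d hd
  by_contra hne
  obtain ⟨u, rfl⟩ : ∃ u : Fin 4 →₀ ℕ, u.mapDomain Fin.succ = d := by
    by_contra hu
    push Not at hu
    exact hne (coeff_rename_eq_zero _ _ _ fun u h => (hu u h).elim)
  rw [coeff_rename_mapDomain _ (Fin.succ_injective 4)] at hne
  rw [Finsupp.degree_mapDomain] at hd
  exact hne (hF u hd)

/-- Hence `z^p + F ∈ 𝔪^{(p)}` (symbolic power, witness `s = 1`) when `ord₀ F ≥ p`: together with §3–§4, at an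
isolated `p`-fold point the symbolic order of `z^p + F` is EXACTLY `p` at the origin and `< p` at every
other prime under it. [cite: Matsumura1987, §6 / Thm. 4.1 (symbolic powers)] -/
theorem hyp_mem_symbPow_idealOfVars {p : ℕ} {F : MvPolynomial (Fin 4) L}
    (hF : (p : ℕ∞) ≤ ordZero F) :
    hyp p F ∈ Resolution.HironakaScheme.symbPow L (MvPolynomial.idealOfVars (Fin (4 + 1)) L) p :=
  Resolution.HironakaScheme.mem_symbPow_of_mem_pow Literature.RingTheory.MvPolynomial.idealOfVars_ne_top
    (hyp_mem_idealOfVars_pow hF)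

end SymbolicPower

end Summit.ResolutionOfSingularities.ResolutionOfSingularities.Theorems.PIDim4

end
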